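import Mathlib
import Summits.Ventures.DiscreteObjects.Mahler.TraceLiftMeasure

/-!
# Salem certificates from sign changes (venture `DiscreteObjects`, target L)

Cell `pub-namedobj`, seat `pub-namedobj-mahler` (gen 10). Framing: lottery ticket; floor = certified
bounds/negative ranges.

A wrapper around `salem_traceLift_certificate` that takes only RATIONAL SIGN DATA: for a monic `Q ∈ ℤ[X]` of
degree `d`, a strictly increasing list of `d` points in `[-2, 2]` at which `Q` alternates in sign (so `Q` has
`d - 1` roots in `(-2, 2)`), and one more sign change on an interval `(a, b)` outside `[-2, 2]`, the reciprocal
lift `P = traceLift Q` is a Salem polynomial with `M(P) + M(P)⁻¹ = |y|` for the root `y ∈ (a, b)`.  For a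
concrete `Q` every hypothesis is a `norm_num` computation, so a kernel enclosure of a Salem-type measure costs a
dozen lines (cf. `MRWDegree8Measure`, `MRWDegree14Measure`, `MRWDegree18Measure`, `CensusDeg10Salem*`, which
were written out by hand before this wrapper).

* `exists_roots_of_sign_chain` — interleaved roots from a chain of sign changes (IVT);
* `salem_certificate_of_signs` — the wrapper.
-/

namespace Summit.Ventures.DiscreteObjects.Mahler

open Polynomial

/-- A root strictly between two points where a continuous function takes values of opposite signs. -/
theorem exists_root_of_mul_neg {g : ℝ → ℝ} (hg : Continuous g) {a b : ℝ} (hab : a < b)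
    (h : g a * g b < 0) : ∃ y, a < y ∧ y < b ∧ g y = 0 := by
  rcases lt_or_gt_of_ne (show g a ≠ 0 by intro h0; rw [h0, zero_mul] at h; exact lt_irrefl _ h) with ha | ha
  · have hb : 0 < g b := by nlinarith
    obtain ⟨y, hy, hgy⟩ := intermediate_value_Ioo hab.le hg.continuousOn ⟨ha, hb⟩
    exact ⟨y, hy.1, hy.2, hgy⟩
  · have hb : g b < 0 := by nlinarith
    obtain ⟨y, hy, hgy⟩ := intermediate_value_Ioo' hab.le hg.continuousOn ⟨hb, ha⟩
    exact ⟨y, hy.1, hy.2, hgy⟩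

/-- **Interleaved roots from a chain of sign changes.**  If `p :: ps` is strictly increasing and `g` changes
sign between consecutive points, there is a strictly increasing list of `|ps|` roots of `g`, each `> p` and each
below some point of `ps`. -/
theorem exists_roots_of_sign_chain {g : ℝ → ℝ} (hg : Continuous g) :
    ∀ (ps : List ℝ) (p : ℝ), List.IsChain (· < ·) (p :: ps) →
      List.IsChain (fun a b => g a * g b < 0) (p :: ps) →
      ∃ rs : List ℝ, rs.length = ps.length ∧ List.IsChain (· < ·) rs ∧
        (∀ r ∈ rs, p < r ∧ g r = 0) ∧ (∀ r ∈ rs, ∃ q ∈ ps, r < q) := by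
  intro ps
  induction ps with
  | nil =>
    intro p _ _
    exact ⟨[], rfl, List.isChain_nil, fun r hr => by simp at hr, fun r hr => by simp at hr⟩
  | cons q ps ih =>
    intro p hlt hsg
    rw [List.isChain_cons_cons] at hlt hsg
    obtain ⟨hpq, hlt'⟩ := hlt
    obtain ⟨hsign, hsg'⟩ := hsg
    obtain ⟨r, hpr, hrq, hgr⟩ := exists_root_of_mul_neg hg hpq hsign
    obtain ⟨rs', hlen, hchain, hroots, habove⟩ := ih q hlt' hsg'
    refine ⟨r :: rs', by simp [hlen], ?_, ?_, ?_⟩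
    · rw [List.isChain_cons]
      refine ⟨fun y hy => ?_, hchain⟩
      cases rs' with
      | nil => simp at hy
      | cons r' rs'' =>
        simp only [List.head?_cons, Option.mem_def, Option.some.injEq] at hy
        rw [← hy]
        have := (hroots r' (by simp)).1
        linarith
    · intro x hx
      rcases List.mem_cons.mp hx with rfl | hx
      · exact ⟨hpr, hgr⟩
      · obtain ⟨h1, h2⟩ := hroots x hx
        exact ⟨lt_trans hpq h1, h2⟩
    · intro x hx
      rcases List.mem_cons.mp hx with rfl | hx
      · exact ⟨q, by simp, hrq⟩
      · obtain ⟨q', hq', hxq'⟩ := habove x hx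
        exact ⟨q', List.mem_cons_of_mem q hq', hxq'⟩

/-- **Salem certificate from sign data.**  Let `Q ∈ ℤ[X]` be monic of degree `d`, `pts` a strictly
increasing list of `d` real points in `[-2, 2]` at which `Q` alternates in sign, and `(a, b)` an interval with
`b < -2` or `2 < a` on which `Q` changes sign.  Then for the root `y ∈ (a, b)`:
`1 < M(traceLift Q)` and `M(traceLift Q) + M(traceLift Q)⁻¹ = |y|`. -/
theorem salem_certificate_of_signs {Q : ℤ[X]} (hQ : Q.Monic) (pts : List ℝ)
    (hlen : pts.length = Q.natDegree) (hchain : List.IsChain (· < ·) pts)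
    (hrange : ∀ p ∈ pts, -2 ≤ p ∧ p ≤ 2)
    (hsign : List.IsChain (fun a b => aeval a Q * aeval b Q < 0) pts)
    {a b : ℝ} (hab : a < b) (hout : b < -2 ∨ 2 < a) (hsignab : aeval a Q * aeval b Q < 0) :
    ∃ y : ℝ, a < y ∧ y < b ∧ 1 < intMahlerMeasure (traceLift Q) ∧
      intMahlerMeasure (traceLift Q) + (intMahlerMeasure (traceLift Q))⁻¹ = |y| := by
  classical
  set g : ℝ → ℝ := fun y => aeval y Q with hgdef
  have hg : Continuous g := by
    rw [hgdef]
    simp only [← eval_map_algebraMap]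
    exact Polynomial.continuous _
  have hgC : ∀ y : ℝ, aeval (y : ℂ) Q = ((g y : ℝ) : ℂ) := by
    intro y
    rw [hgdef]
    exact (aeval_algebraMap_apply ℂ y Q)
  -- the outer root
  obtain ⟨y₀, hay, hyb, hgy⟩ := exists_root_of_mul_neg hg hab hsignab
  have hy₀big : 2 < |y₀| := by
    rcases hout with h | h
    · rw [abs_of_neg (by linarith)]; linarith
    · rw [abs_of_pos (by linarith)]; linarith
  -- the inner roots
  obtain ⟨p, ps, hpts⟩ : ∃ p ps, pts = p :: ps := by
    cases pts with
    | nil =>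
      exfalso
      -- `d = 0`: `Q = 1` has no sign change
      have hd : Q.natDegree = 0 := by rw [← hlen]; rfl
      have hQ1 : Q = 1 := eq_one_of_monic_natDegree_zero hQ hd
      rw [hQ1] at hsignab
      simp at hsignab
      linarith
    | cons p ps => exact ⟨p, ps, rfl⟩
  subst hpts
  obtain ⟨rs, hrslen, hrschain, hrsroot, hrsabove⟩ := exists_roots_of_sign_chain hg ps p hchain hsign
  have hrs2 : ∀ r ∈ rs, |r| ≤ 2 := by
    intro r hr
    obtain ⟨hpr, -⟩ := hrsroot r hr
    obtain ⟨q, hq, hrq⟩ := hrsabove r hr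
    have hp2 := (hrange p (by simp)).1
    have hq2 := (hrange q (List.mem_cons_of_mem p hq)).2
    rw [abs_le]; constructor <;> linarith
  -- the multiset of all `d` roots
  set s : Multiset ℝ := y₀ ::ₘ (rs : Multiset ℝ) with hs
  have hrsnodup : rs.Nodup := (List.isChain_iff_pairwise.mp hrschain).imp (fun h => ne_of_lt h)
  have hy₀rs : y₀ ∉ rs := fun h => by have := hrs2 y₀ h; linarith
  have hnodup : s.Nodup := by
    rw [hs, Multiset.nodup_cons]
    exact ⟨by rwa [Multiset.mem_coe], Multiset.coe_nodup.mpr hrsnodup⟩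
  have hcard : Multiset.card s = Q.natDegree := by
    rw [hs, Multiset.card_cons, Multiset.coe_card, hrslen, ← hlen, List.length_cons]
  have hroot : ∀ y ∈ s, aeval (y : ℂ) Q = 0 := by
    intro y hy
    rw [hgC]
    rw [hs, Multiset.mem_cons, Multiset.mem_coe] at hy
    rcases hy with rfl | hy
    · rw [hgy]; simp
    · rw [(hrsroot y hy).2]; simp
  have hy₀s : y₀ ∈ s := by rw [hs]; exact Multiset.mem_cons_self _ _
  have hsmall : ∀ y ∈ s.erase y₀, |y| ≤ 2 := by
    intro y hy
    rw [hs, Multiset.erase_cons_head, Multiset.mem_coe] at hy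
    exact hrs2 y hy
  obtain ⟨-, hM1, hMM⟩ := salem_traceLift_certificate hQ s hnodup hcard hroot hy₀s hy₀big hsmall
  exact ⟨y₀, hay, hyb, hM1, hMM⟩

end Summit.Ventures.DiscreteObjects.Mahler
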